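import Literature.NumberTheory.EllipticCurves.CastellaLiuWan2022.GreenbergDivisibilityAwayFromCyclotomicCorollaries
import Summits.BirchSwinnertonDyer.Rank1Residual.X11b.FrameIdealRigidity
import Summits.BirchSwinnertonDyer.BirchSwinnertonDyer.Theorems.AdditiveBranchIMCTameBranchSocketOfTwoVar
import Summits.BirchSwinnertonDyer.BirchSwinnertonDyer.Theorems.SignedBaseChangeAnticyclotomicEisensteinDivisibilityFrameConcordance

/-!
# The anticyclotomic restriction of a Castella–Liu–Wan pair is a non-zero multiple of the ♭-frame

Helper for the crux `GordTwoRankZeroOffCaseOne` (stmt-BirchSwinnertonDyer-19357), line `three_field_road`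
v25, registered PORT stub `stub_tameAnticycRestrictionR0` (director-bsd g18 K1 WORD 2026-08-29: clause (ii)
of the tame seam is an in-house port from the DISPLAY identities; it is not a printed sentence for the
symmetric branch `ξ = ω^{(p+1)/2}∘N`).

THE STATEMENT (§2). For a CLW pair `(A, B)` (`CastellaLiuWan2022.IsCastellaLiuWanLFunction₂ ι 𝔭′ κ₁ κ γ₁ γ f
Ω_∞ C Ω_p A B`, `γ₁ ∈ ker κ`) and a ♭-frame `Q` of the same newform at the ι-prime `𝔭`
(`R1.IsBDPLFunctionInt p ι 𝔭 κ γ f Ω_K Ω_p′ Q`), at a level `N` with `p ∣ N`, `a_p(f) = 0`, all periods and `C`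
non-zero with `‖ι⁻¹C‖ = 1`, `p` odd, `K` imaginary quadratic, `κ` anticyclotomic with generator `γ`:
there is `D ∈ 𝓞_{ℂ_p}⟦T⟧` with `A(0,·) = B(0,·)·D` and `(D) ⊆ (Q)`, and `D ≠ 0` as soon as `Q ≠ 0`.

THE PROOF. §1: along the powers `φ₀^{p^a j}` of the interpolation character (`exists_interpolationCharacter`)
the values of `A(0,·)` (CLW display on the line `T₁ = 0`: `IsCastellaLiuWanLFunction₂.hasValueAt₂_line` +
`IntSeries.hasValueAt₂_zero_left_iff`) and of `B(0,·)·Q` (Castella's display) at `x^j − 1` differ by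
`c·b^j`, `c = ι⁻¹(C/(2i))`, by the display comparison `clwInterpolationValue_diag_eq_mul_bdpInterpolationValue`
(factor `φ(ϖ_𝔭′)⁻² · C · π^{2n+1}Ω_K^{4n}/((2πi)^{2n+1}Ω_∞^{4n})`) and the period rescaling; §0 is the scalar
identity behind it. §2: `c ∈ 𝓞_{ℂ_p}` (`‖2‖_p = ‖ι⁻¹ i‖_p = 1`), so `X11b.R1.exists_unit_mul_eq_of_values` (frames
tied along the powers of a principal unit differ by a unit — no unit content needed) gives
`A(0,·) = U·c·B(0,·)·Q`, `D := U·c·Q`. §3: on the `CellGordTwo` tame sub-row at a tame-road field the ♭-frame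
comes from Hsieh 2014 Thm. B (`TameBranchSocket.exists_frameInt_unitContent_ramifiedSteinberg`) and has unit
content, so `D ≠ 0`.
-/

set_option linter.dupNamespace false

open scoped Classical

open Function PowerSeries NumberField IsDedekindDomain Field WeierstrassCurve CongruenceSubgroup
  Literature.NumberTheory.GaloisRepresentations Literature.NumberTheory.EllipticCurves
  Literature.NumberTheory.EllipticCurves.ModularForms Literature.NumberTheory.EllipticCurves.Rank1Residual
  Literature.NumberTheory.EllipticCurves.CastellaLiuWan2022 Literature.NumberTheory.EllipticCurves.GreenbergVatsal2000
  Summit.BirchSwinnertonDyer.Rank1Residual Summit.BirchSwinnertonDyer.Rank1Residual.Additive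
  Summit.BirchSwinnertonDyer.Rank1Residual.X11b Summit.BirchSwinnertonDyer.Rank1Residual.X11b.LambdaSupply
  Summit.BirchSwinnertonDyer.Rank1Residual.X11b.Three.LambdaSupply
  Summit.BirchSwinnertonDyer.BirchSwinnertonDyer.Theorems

namespace Summit.BirchSwinnertonDyer.BirchSwinnertonDyer.Theorems.TameAnticycRestriction

variable {K : Type} [Field K] [NumberField K] {p : ℕ} [Fact p.Prime]

/-! ### §0 Scalars -/

/-- The scalar identity behind the display comparison along `φ₀^{k}` of type `(n, −n)`:
`(w^k)⁻² · C · π^{2n+1}Ω_K^{4n} / ((2πi)^{2n+1} Ω_∞^{4n}) = (w⁻²)^k · ((−4)⁻¹(Ω_K/Ω_∞)^4)^n · C · (2i)⁻¹`.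
[folklore] -/
theorem ratio_identity (w C ΩK Ωinf : ℂ) (hw : w ≠ 0) (hΩinf : Ωinf ≠ 0) (k n : ℕ) :
    ((w ^ k) ^ 2)⁻¹ * C * ((Real.pi : ℂ) ^ (2 * n + 1) * ΩK ^ (4 * n)) /
        ((2 * Real.pi * Complex.I) ^ (2 * n + 1) * Ωinf ^ (4 * n)) =
      ((w ^ 2)⁻¹) ^ k * ((ΩK / Ωinf) ^ 4 / (2 * Complex.I) ^ 2) ^ n * (C * (2 * Complex.I)⁻¹) := by
  have hπ : (Real.pi : ℂ) ≠ 0 := Complex.ofReal_ne_zero.mpr Real.pi_ne_zero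
  have h2I : (2 * Complex.I : ℂ) ≠ 0 := mul_ne_zero two_ne_zero Complex.I_ne_zero
  have hpow : (2 * Real.pi * Complex.I) ^ (2 * n + 1) =
      ((2 * Complex.I) ^ 2) ^ n * (2 * Complex.I) * (Real.pi : ℂ) ^ (2 * n + 1) := by
    rw [show (2 * Real.pi * Complex.I : ℂ) = (2 * Complex.I) * Real.pi by ring, mul_pow, pow_succ, pow_mul]
  have e1 : ((w ^ 2)⁻¹) ^ k = ((w ^ k) ^ 2)⁻¹ := by
    rw [inv_pow, ← pow_mul, ← pow_mul, mul_comm]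
  have e2 : ((ΩK / Ωinf) ^ 4 / (2 * Complex.I) ^ 2) ^ n =
      ΩK ^ (4 * n) / (Ωinf ^ (4 * n) * ((2 * Complex.I) ^ 2) ^ n) := by
    rw [div_pow, div_pow, div_pow, div_div, ← pow_mul ΩK, ← pow_mul Ωinf]
  have hA : (w ^ k) ^ 2 ≠ 0 := pow_ne_zero _ (pow_ne_zero _ hw)
  rw [hpow, e1, e2]
  field_simp

/-- `‖ι⁻¹(2i)‖_p = 1` for odd `p`. [folklore] -/
theorem norm_two_mul_I_eq_one (hp2 : p ≠ 2) (ι : PadicAlgCl p ≃+* ℂ) :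
    ‖((ι.symm (2 * Complex.I) : PadicAlgCl p) : ℂ_[p])‖ = 1 := by
  have hp : p.Prime := Fact.out
  have hIn : ‖((ι.symm Complex.I : PadicAlgCl p) : ℂ_[p])‖ = 1 := by
    have hsq : ((ι.symm Complex.I : PadicAlgCl p) : ℂ_[p]) ^ 2 = -1 := by
      rw [PadicComplex.coe_eq, ← map_pow, ← map_pow, Complex.I_sq, map_neg, map_one, map_neg, map_one]
    have h := congrArg norm hsq
    rw [norm_pow, norm_neg, norm_one] at h
    exact (pow_eq_one_iff_of_nonneg (norm_nonneg _) two_ne_zero).mp h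
  have h2n : ‖(2 : ℂ_[p])‖ = 1 := by
    have h2 : ‖((2 : ℤ) : ℚ_[p])‖ = 1 := by
      refine le_antisymm (Padic.norm_int_le_one 2) (le_of_not_gt fun hlt => ?_)
      rw [Padic.norm_intCast_lt_one_iff] at hlt
      have : p ∣ 2 := by exact_mod_cast hlt
      exact hp2 ((Nat.prime_dvd_prime_iff_eq hp Nat.prime_two).mp this)
    have e : (((algebraMap ℚ_[p] (PadicAlgCl p) ((2 : ℤ) : ℚ_[p]) : PadicAlgCl p)) : ℂ_[p]) = 2 := by
      rw [map_intCast, PadicComplex.coe_eq, map_intCast]; norm_num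
    rw [← e, PadicComplex.norm_extends']
    exact h2
  rw [map_mul, PadicComplex.coe_eq, map_mul, norm_mul, ← PadicComplex.coe_eq, ← PadicComplex.coe_eq, hIn,
    mul_one, show ((ι.symm 2 : PadicAlgCl p) : ℂ_[p]) = 2 by rw [map_ofNat, PadicComplex.coe_eq, map_ofNat]]
  exact h2n

/-! ### §1 Test values along the powers of the interpolation character -/

/-- **The values of `A(0,·)` and of `B(0,·)·Q` along `φ₀^{p^a j}`.** For a CLW pair `(A, B)` at
`(ι, 𝔭′, κ₁, κ; γ₁, γ)` with `κ γ₁ = 1` and a ♭-frame `Q` at `(ι, 𝔭, κ, γ)` of the same `f` (`p ∣ N`,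
`a_p(f) = 0`): there are a principal unit `x ≠ 1` with `‖x − 1‖ < p⁻¹`, `b ≠ 0`, and values
`V_j = (B(0,·)·Q)(x^j − 1)`, `V′_j = A(0,·)(x^j − 1)` with `V′_j = ι⁻¹(C/(2i)) · b^j · V_j` for `j ≥ 1`.
[cite: CastellaLiuWan2022, (1.0.3) p. 3 and Thm. 8.2.1 p. 85 (Forum Math. Sigma 10 (2022) e110)]
[cite: Castella2018, Thm. 3.1 (arXiv:1704.06608 p. 9)] -/
theorem exists_testValues (hp2 : p ≠ 2) (hK : IsImaginaryQuadratic K) {N : ℕ}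
    {f : CuspForm (Gamma0 N) 2} (hpN : p ∣ N) (hap : cuspCoeff f p = 0)
    {ι : PadicAlgCl p ≃+* ℂ} {𝔭 𝔭' : HeightOneSpectrum (𝓞 K)} {κ₁ κ : ZpExtension K p}
    {γ₁ γ : absoluteGaloisGroup K} (hκ : κ.IsAnticyclotomic) (hγ : κ.IsTopGenerator γ) (hγ₁ : κ γ₁ = 1)
    {Ωinf C ΩK : ℂ} {Ωp ΩpQ : ℂ_[p]} {A B : PowerSeries (PowerSeries (PadicComplexInt p))}
    {Q : PowerSeries (PadicComplexInt p)}
    (hΩinf : Ωinf ≠ 0) (hΩK : ΩK ≠ 0) (hΩp : Ωp ≠ 0) (hΩpQ : ΩpQ ≠ 0)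
    (hAB : IsCastellaLiuWanLFunction₂ ι 𝔭' κ₁ κ γ₁ γ f Ωinf C Ωp A B)
    (hQ : R1.IsBDPLFunctionInt p ι 𝔭 κ γ f ΩK ΩpQ Q) :
    ∃ (x b : ℂ_[p]) (V V' : ℕ → ℂ_[p]), ‖x - 1‖ < (p : ℝ)⁻¹ ∧ x ≠ 1 ∧ b ≠ 0 ∧
      (∀ j, IntSeries.HasValueAt (PowerSeries.constantCoeff B * Q) (x ^ j - 1) (V j)) ∧
      (∀ j, IntSeries.HasValueAt (PowerSeries.constantCoeff A) (x ^ j - 1) (V' j)) ∧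
      ∀ j, 0 < j → V' j = ((ι.symm (C * (2 * Complex.I)⁻¹) : PadicAlgCl p) : ℂ_[p]) * b ^ j * V j := by
  have hp : p.Prime := Fact.out
  -- the interpolation character and its value at `γ`
  obtain ⟨φ₀, m, ψ, hm, hunr, hinf, hav, hfac, hx1, hne⟩ :=
    exists_interpolationCharacter hp2 ι K κ hK hκ γ hγ
  set eU := (FramedRep.unitsContinuousMulEquivOfUnique (Fin 1) (PadicAlgCl p) :
    (PadicAlgCl p)ˣ →ₜ* GL (Fin 1) (PadicAlgCl p)) with heU
  set x₀ : ℂ_[p] := avatarValueAt (eU.comp ψ) γ with hx₀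
  have hunr' : ∀ v : HeightOneSpectrum (𝓞 K), ((p : ℕ) : 𝓞 K) ∉ v.asIdeal → φ₀.IsUnramifiedAt v :=
    fun v _ => hunr v
  -- `a` with `‖x₀^{p^a} − 1‖ < p⁻¹`
  have hpinv : 0 < (p : ℝ)⁻¹ := inv_pos.mpr (by exact_mod_cast hp.pos)
  obtain ⟨a, ha⟩ : ∃ a : ℕ, ‖x₀ ^ p ^ a - 1‖ < (p : ℝ)⁻¹ := by
    have h := tendsto_pow_prime_pow_padicComplex (p := p) hx1
    have hev := h.eventually (Metric.ball_mem_nhds (1 : ℂ_[p]) hpinv)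
    obtain ⟨a, ha⟩ := hev.exists
    exact ⟨a, by rwa [dist_eq_norm] at ha⟩
  set x : ℂ_[p] := x₀ ^ p ^ a with hxdef
  have hxne : x ≠ 1 := hne a
  have hxlt : ‖x - 1‖ < 1 := ha.trans (inv_lt_one_of_one_lt₀ (by exact_mod_cast hp.one_lt))
  have hpt : ∀ j : ℕ, ‖x ^ j - 1‖ < 1 := fun j => (R1.norm_pow_sub_one_le hxlt j).trans_lt hxlt
  -- generic values of `B(0,·)`, `Q`, `A(0,·)` at the points `x^j − 1`
  choose VB hVB using fun j : ℕ => intSeries_exists_hasValueAt (PowerSeries.constantCoeff B) (hpt j)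
  choose VQ hVQ using fun j : ℕ => intSeries_exists_hasValueAt Q (hpt j)
  choose V' hV' using fun j : ℕ => intSeries_exists_hasValueAt (PowerSeries.constantCoeff A) (hpt j)
  -- the period ratio and the multiplier base
  set β : ℂ_[p] := ((ι.symm ((ΩK / Ωinf) ^ 4 / (2 * Complex.I) ^ 2) : PadicAlgCl p) : ℂ_[p]) * (Ωp / ΩpQ) ^ 4 with hβ
  have hβ0 : β ≠ 0 := by
    refine mul_ne_zero ?_ (pow_ne_zero _ (div_ne_zero hΩp hΩpQ))
    rw [PadicComplex.coe_eq]
    exact (map_ne_zero_iff _ (algebraMap (PadicAlgCl p) ℂ_[p]).injective).mpr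
      ((map_ne_zero_iff _ ι.symm.injective).mpr (div_ne_zero (pow_ne_zero _ (div_ne_zero hΩK hΩinf))
        (pow_ne_zero _ (mul_ne_zero two_ne_zero Complex.I_ne_zero))))
  set w₀ : ℂ := φ₀.valueAtUniformizer 𝔭' with hw₀
  have hw₀0 : w₀ ≠ 0 := HeckeCharacter.valueAtUniformizer_ne_zero' φ₀ 𝔭'
  set Wc : ℂ_[p] := ((ι.symm ((w₀ ^ 2)⁻¹) : PadicAlgCl p) : ℂ_[p]) with hWc
  have hWc0 : Wc ≠ 0 := by
    rw [hWc, PadicComplex.coe_eq]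
    exact (map_ne_zero_iff _ (algebraMap (PadicAlgCl p) ℂ_[p]).injective).mpr
      ((map_ne_zero_iff _ ι.symm.injective).mpr (inv_ne_zero (pow_ne_zero _ hw₀0)))
  set b : ℂ_[p] := Wc ^ p ^ a * β ^ (m * p ^ a) with hbdef
  have hb : b ≠ 0 := mul_ne_zero (pow_ne_zero _ hWc0) (pow_ne_zero _ hβ0)
  refine ⟨x, b, fun j => VB j * VQ j, V', ha, hxne, hb,
    fun j => intSeries_hasValueAt_mul (hpt j) (hVB j) (hVQ j), hV', fun j hj => ?_⟩
  -- the relation at `φ₀^{p^a j}`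
  set k : ℕ := p ^ a * j with hk
  have hn0 : 0 < m * k := Nat.mul_pos hm (Nat.mul_pos (pow_pos hp.pos a) hj)
  have hunrk : ∀ v : HeightOneSpectrum (𝓞 K), (φ₀ ^ k).IsUnramifiedAt v :=
    fun v => isUnramifiedAt_pow' (hunr v) k
  have hinfk : (φ₀ ^ k).HasInfinityType (fun _ ↦ ((m * k : ℕ) : ℤ)) (fun _ ↦ -((m * k : ℕ) : ℤ)) := by
    have h := HasInfinityType.pow_nat hinf k
    convert h using 2 <;> push_cast <;> ring
  have havk : IsPAdicAvatarOf ι (φ₀ ^ k) (eU.comp (ψ ^ k)) := isPAdicAvatarOf_pow ι hav hunr' k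
  have hfack : FactorsThroughZp κ (eU.comp (ψ ^ k)) := factorsThroughZp_unitsChar_pow κ hfac k
  have hvalk : avatarValueAt (eU.comp (ψ ^ k)) γ = x ^ j := by
    rw [heU, avatarValueAt_unitsChar_pow, ← heU, ← hx₀, hxdef, ← pow_mul, hk]
  -- the ♭-value and the CLW value at `x^j − 1`
  have h1 := hQ (φ₀ ^ k) (m * k) hn0 hunrk hinfk (eU.comp (ψ ^ k)) havk hfack
  have hBv : IntSeries.HasValueAt₂ B 0 (avatarValueAt (eU.comp (ψ ^ k)) γ - 1) (VB j) := by
    rw [IntSeries.hasValueAt₂_zero_left_iff, hvalk]; exact hVB j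
  have h2 := (IntSeries.hasValueAt₂_zero_left_iff A _ _).mp
    (hAB.hasValueAt₂_line hγ₁ (Nat.one_le_iff_ne_zero.mpr hn0.ne') hinfk hunrk havk hfack hBv)
  rw [hvalk] at h1 h2
  have e1 : VQ j = _ := (hVQ j).unique h1
  have e2 : V' j = _ := (hV' j).unique h2
  -- the display comparison on the diagonal and the scalar identity
  have hhv : heckeValueExtZero (φ₀ ^ k) 𝔭' = w₀ ^ k := by
    rw [heckeValueExtZero_of_isUnramifiedAt (hunrk 𝔭'), hw₀]
    clear hk
    induction k with
    | zero => rw [pow_zero, pow_zero, valueAtUniformizer_one']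
    | succ k ih => rw [pow_succ, pow_succ, HeckeCharacter.valueAtUniformizer_mul', ih]
  have key := clwInterpolationValue_diag_eq_mul_bdpInterpolationValue hpN f hap 𝔭 𝔭' (φ₀ ^ k) (m * k)
    (Ωinf := Ωinf) hΩK C
  rw [hhv, ratio_identity w₀ C ΩK Ωinf hw₀0 hΩinf k (m * k)] at key
  -- assemble
  have hΩpow : Ωp ^ (2 * (m * k + m * k)) = (Ωp / ΩpQ) ^ (4 * (m * k)) * ΩpQ ^ (4 * (m * k)) := by
    rw [← mul_pow, div_mul_cancel₀ _ hΩpQ]; ring_nf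
  have hbj : b ^ j = Wc ^ k * β ^ (m * k) := by
    rw [hbdef, mul_pow, ← pow_mul, ← pow_mul, hk, mul_assoc]
  beta_reduce
  rw [e2, e1, key, hΩpow, hbj, hβ, hWc]
  simp only [map_mul, map_pow, map_div₀, map_inv₀, PadicComplex.coe_eq]
  ring

/-! ### §2 The restriction is a multiple of the ♭-frame -/

/-- **`A(0,·) = B(0,·)·D` with `(D) ⊆ (Q)`** (and `D ≠ 0` when `Q ≠ 0`): §1 and
`X11b.R1.exists_unit_mul_eq_of_values` applied to `Q′ := A(0,·)` and `c·B(0,·)·Q`, `c = ι⁻¹(C/(2i)) ∈ 𝓞_{ℂ_p}`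
(`‖ι⁻¹C‖ = 1`, `‖ι⁻¹(2i)‖ = 1`), `D := U·c·Q`.
[cite: CastellaLiuWan2022, (1.0.3) p. 3 and Thm. 8.2.1 p. 85 (Forum Math. Sigma 10 (2022) e110)]
[cite: Castella2018, Thm. 3.1 (arXiv:1704.06608 p. 9)] [cite: Washington1997, §5.1] -/
theorem exists_constantCoeff_eq_mul (hp2 : p ≠ 2) (hK : IsImaginaryQuadratic K) {N : ℕ}
    {f : CuspForm (Gamma0 N) 2} (hpN : p ∣ N) (hap : cuspCoeff f p = 0)
    {ι : PadicAlgCl p ≃+* ℂ} {𝔭 𝔭' : HeightOneSpectrum (𝓞 K)} {κ₁ κ : ZpExtension K p}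
    {γ₁ γ : absoluteGaloisGroup K} (hκ : κ.IsAnticyclotomic) (hγ : κ.IsTopGenerator γ) (hγ₁ : κ γ₁ = 1)
    {Ωinf C ΩK : ℂ} {Ωp ΩpQ : ℂ_[p]} {A B : PowerSeries (PowerSeries (PadicComplexInt p))}
    {Q : PowerSeries (PadicComplexInt p)}
    (hΩinf : Ωinf ≠ 0) (hC : ‖((ι.symm C : PadicAlgCl p) : ℂ_[p])‖ = 1) (hΩK : ΩK ≠ 0) (hΩp : Ωp ≠ 0)
    (hΩpQ : ΩpQ ≠ 0) (hAB : IsCastellaLiuWanLFunction₂ ι 𝔭' κ₁ κ γ₁ γ f Ωinf C Ωp A B)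
    (hQ : R1.IsBDPLFunctionInt p ι 𝔭 κ γ f ΩK ΩpQ Q) :
    ∃ D : PowerSeries (PadicComplexInt p),
      PowerSeries.constantCoeff A = PowerSeries.constantCoeff B * D ∧ (Q ≠ 0 → D ≠ 0) ∧
        Ideal.span {D} ≤ Ideal.span {Q} := by
  obtain ⟨x, b, V, V', hx, hx1, hb, hV, hV', hrel⟩ :=
    exists_testValues hp2 hK hpN hap hκ hγ hγ₁ hΩinf hΩK hΩp hΩpQ hAB hQ
  -- the constant `c = ι⁻¹(C/(2i)) ∈ 𝓞_{ℂ_p}`, of norm one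
  set c₀ : ℂ_[p] := ((ι.symm (C * (2 * Complex.I)⁻¹) : PadicAlgCl p) : ℂ_[p]) with hc₀
  have hc₀n : ‖c₀‖ = 1 := by
    rw [hc₀, map_mul, map_inv₀, PadicComplex.coe_eq, map_mul, map_inv₀, norm_mul, norm_inv,
      ← PadicComplex.coe_eq, ← PadicComplex.coe_eq, hC, norm_two_mul_I_eq_one hp2 ι, inv_one, mul_one]
  let c : PadicComplexInt p := ⟨c₀, mem_padicComplexInt_iff.mpr hc₀n.le⟩
  have hc0 : c ≠ 0 := by
    intro h
    have : c₀ = 0 := by simpa [c] using congrArg (fun z : PadicComplexInt p => (z : ℂ_[p])) h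
    rw [this, norm_zero] at hc₀n
    exact zero_ne_one hc₀n
  have hp : p.Prime := Fact.out
  have hxlt : ‖x - 1‖ < 1 := hx.trans (inv_lt_one_of_one_lt₀ (by exact_mod_cast hp.one_lt))
  have hpt : ∀ j : ℕ, ‖x ^ j - 1‖ < 1 := fun j => (R1.norm_pow_sub_one_le hxlt j).trans_lt hxlt
  -- values of `c·B(0,·)·Q`
  have hVc : ∀ j, IntSeries.HasValueAt (PowerSeries.C c * (PowerSeries.constantCoeff B * Q)) (x ^ j - 1)
      ((c : ℂ_[p]) * V j) := fun j => SignedBaseChangeAcDivFrameConcordance.intSeries_hasValueAt_C_mul c (hpt j) (hV j)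
  have hrel' : ∀ j, 0 < j → V' j = b ^ j * ((c : ℂ_[p]) * V j) := by
    intro j hj
    rw [hrel j hj]
    show _ = b ^ j * (c₀ * V j)
    ring
  obtain ⟨U, hU, hUQ⟩ := R1.exists_unit_mul_eq_of_values hx hx1 hb hVc hV' hrel'
  refine ⟨U * PowerSeries.C c * Q, ?_, fun hQ0 => ?_, ?_⟩
  · rw [hUQ]; ring
  · exact mul_ne_zero (mul_ne_zero hU.ne_zero (fun h => hc0 (by
      have := congrArg PowerSeries.constantCoeff h
      rwa [PowerSeries.constantCoeff_C, map_zero] at this))) hQ0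
  · exact Ideal.span_singleton_le_span_singleton.mpr (Dvd.intro_left _ rfl)

/-! ### §3 On the tame road -/

/-- **The anticyclotomic restriction of a CLW pair on the `CellGordTwo` tame sub-row** — for `W/ℚ` globally
minimal with `p ≥ 5` of additive reduction (`Addv W p`, so `a_p(f_E) = 0` and `p ∣ N`), `ρ̄_{E,p}` onto, a
tame-road configuration at the imaginary quadratic `K` (a Wan prime `q ∣ d_K`, `q ‖ N`, every other `ℓ ∣ N`
split, `p` split), Hsieh 2014 Thm. B as the named hypothesis `hB`: for every anticyclotomic datum
`(κ, γ, 𝔭, 𝔭′, ι′)` with `𝔭` induced by `ι′`, every completing pair `(κ₁, γ₁)` and every CLW pair `(A, B)` with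
genuine period data, there are a ♭-frame `(Ω_K′, Ω_p′, Q′)` at `(ι′, 𝔭, κ, γ, f)` and `D ≠ 0` with
`A(0,·) = B(0,·)·D`, `(D) ⊆ (Q′)` — the frame from `TameBranchSocket.exists_frameInt_unitContent_ramifiedSteinberg`
(unit content, hence `Q′ ≠ 0`), then §2. CONDITIONAL on `hB`.
[cite: Hsieh2014, Thm. B p. 713 (Doc. Math. 19)] [cite: CastellaLiuWan2022, (1.0.3) p. 3 and Thm. 8.2.1 p. 85 (Forum Math. Sigma 10 (2022) e110)]
[cite: Castella2018, Thm. 3.1 (arXiv:1704.06608 p. 9)] -/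
theorem exists_frame_and_restriction
    (hB : Hsieh2014.thmB_exists_isHsiehLFunction_coeff_norm_eq_one_unrPeriod_ramifiedSteinberg)
    (W : WeierstrassCurve ℚ) [W.IsElliptic] (p : ℕ) [Fact p.Prime] (K : Type) [Field K] [NumberField K]
    [W.IsGloballyMinimal] (hp5 : 5 ≤ p) (hadd : Addv W p) (hsurj : Surj W p) (hK : IsImaginaryQuadratic K)
    (hsplit : ((Ideal.span {(p : ℤ)}).primesOver (𝓞 K)).ncard = 2)
    {q : ℕ} [Fact q.Prime] (hqp : q ≠ p) (hqd : (q : ℤ) ∣ NumberField.discr K)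
    (hmult : W.HasMultiplicativeReductionAtPrime q) (hns : ¬ W.HasSplitMultiplicativeReductionAtPrime q)
    (hsplitq : ∀ ℓ : ℕ, ℓ.Prime → ℓ ∣ W.conductorNorm ℤ → ℓ ≠ q →
      ((Ideal.span {(ℓ : ℤ)}).primesOver (𝓞 K)).ncard = 2)
    {N : ℕ} [NeZero N] (Dt : ModularParametrizationData W N) (hN : W.conductorNorm ℤ = N)
    (κ : ZpExtension K p) (hκ : κ.IsAnticyclotomic) (γ : absoluteGaloisGroup K) [hγ : Fact (κ.IsTopGenerator γ)]
    (𝔭 : HeightOneSpectrum (𝓞 K)) (h𝔭 : ((p : ℕ) : 𝓞 K) ∈ 𝔭.asIdeal) (𝔭' : HeightOneSpectrum (𝓞 K))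
    (ι' : PadicAlgCl p ≃+* ℂ)
    (hind : ∀ (w : InfinitePlace K) (k : 𝓞 K), k ∈ 𝔭.asIdeal ↔ ‖ι'.symm (w.embedding (k : K))‖ < 1)
    (κ₁ : ZpExtension K p) (γ₁ : absoluteGaloisGroup K) [hpair : Fact (ZpExtension.IsTopGeneratorPair κ₁ κ γ₁ γ)]
    (Ωinf C : ℂ) (Ωp : (unrIntegers p)ˣ) (A B : PowerSeries (PowerSeries (PadicComplexInt p)))
    (hΩinf : Ωinf ≠ 0) (hC : ‖((ι'.symm C : PadicAlgCl p) : ℂ_[p])‖ = 1)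
    (hAB : IsCastellaLiuWanLFunction₂ ι' 𝔭' κ₁ κ γ₁ γ Dt.f Ωinf C ((Ωp : unrIntegers p) : ℂ_[p]) A B) :
    ∃ (ΩK' : ℂ) (Ωp' : ℂ_[p]) (Q' D : PowerSeries (PadicComplexInt p)),
      ΩK' ≠ 0 ∧ Ωp' ≠ 0 ∧ R1.IsBDPLFunctionInt p ι' 𝔭 κ γ Dt.f ΩK' Ωp' Q' ∧
      PowerSeries.constantCoeff A = PowerSeries.constantCoeff B * D ∧ D ≠ 0 ∧
        Ideal.span {D} ≤ Ideal.span {Q'} := by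
  have hp : p.Prime := Fact.out
  have hp2 : p ≠ 2 := by omega
  have h2 : Module.finrank ℚ K = 2 := hK.1
  -- `a_p(f) = 0`, `p ∣ N`; `q ‖ N`
  have hap : cuspCoeff Dt.f p = 0 := by
    rw [Dt.isNewformOf.2 p, W.LFunction_apply_eq_zero_of_not_good_of_not_mult p hadd.1 hadd.2 (dvd_refl p),
      Int.cast_zero]
  have hpN : p ∣ N := by
    rw [← hN]; exact (W.dvd_conductorNorm_iff_not_hasGoodReductionAtPrime p).mpr hadd.1
  obtain ⟨hqN, hq2⟩ := TameBranchSocket.dvd_and_not_sq_dvd_of_mult (W := W) hmult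
  have hqN' : q ∣ N := by rw [← hN]; exact hqN
  have hq2' : ¬ q ^ 2 ∣ N := by rw [← hN]; exact hq2
  have hsplitq' : ∀ ℓ : ℕ, ℓ.Prime → ℓ ∣ N → ℓ ≠ q → ((Ideal.span {(ℓ : ℤ)}).primesOver (𝓞 K)).ncard = 2 := by
    rw [← hN]; exact hsplitq
  -- (irr_K) from `Surj`
  have hirr : ∀ ρ : ModPGaloisRep K (ZMod p) 2, (W.baseChange K).IsTorsionGaloisRep p ρ →
      FramedRep.IsAbsolutelyIrreducible ρ :=
    fun ρ hρ ↦ SignedBaseChangeK1FrameData.irrK_framed_of_surj W p hp2 hsurj K h2 ρ hρ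
  -- the ♭-frame of unit content (Hsieh Thm. B)
  obtain ⟨ΩK', Ωp', Q', hΩK', hQ', hμ⟩ :=
    TameBranchSocket.exists_frameInt_unitContent_ramifiedSteinberg hB W K 𝔭 κ γ Dt.f Dt.isNewformOf q hp2 hpN
      hK hsplit h𝔭 hqp hqN' hq2' hqd hmult hns hsplitq' hirr hκ ι' hind
  have hΩp'0 : ((Ωp' : unrIntegers p) : ℂ_[p]) ≠ 0 := fun h ↦ Ωp'.ne_zero (by exact_mod_cast h)
  have hΩp0 : ((Ωp : unrIntegers p) : ℂ_[p]) ≠ 0 := fun h ↦ Ωp.ne_zero (by exact_mod_cast h)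
  have hQ'0 : Q' ≠ 0 := by
    obtain ⟨n, hn⟩ := hμ
    intro h
    rw [h, map_zero] at hn
    exact not_isUnit_zero hn
  obtain ⟨D, hAD, hD0, hDQ⟩ := exists_constantCoeff_eq_mul hp2 hK hpN hap hκ hγ.out
    (Fact.out : ZpExtension.IsTopGeneratorPair κ₁ κ γ₁ γ).apply_left hΩinf hC hΩK' hΩp0 hΩp'0 hAB hQ'
  exact ⟨ΩK', _, Q', D, hΩK', hΩp'0, hQ', hAD, hD0 hQ'0, hDQ⟩

end Summit.BirchSwinnertonDyer.BirchSwinnertonDyer.Theorems.TameAnticycRestriction
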